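import Literature.Barriers.ResolutionOfSingularities.LocalMonomializationFailsPersist
import Literature.AlgebraicGeometry.Resolution.RegularSystemOfParameters
import Literature.RingTheory.UniqueFactorizationDomain.TwoPrimes
import Literature.AlgebraicGeometry.Resolution.OriginTaylor
import Literature.AlgebraicGeometry.Resolution.OriginQuadraticTransform
import Literature.Barriers.ResolutionOfSingularities.LocalMonomializationFailsTowers
import Mathlib.Algebra.MvPolynomial.Monad
import Mathlib.RingTheory.Nakayama
import HarnessLib

/-!
# Discharge of `CutkoskyMonomialPersists`

`Literature/Barriers/ResolutionOfSingularities/LocalMonomializationFailsPersistProofs.lean` —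
the proof of the named fact
`Literature.Barriers.ResolutionOfSingularities.Cutkosky.CutkoskyMonomialPersists`
(`LocalMonomializationFailsPersist.lean`; Cutkosky §3 p. 7: monomial forms persist along a
quadratic transform of the source dominated by the target): `CutkoskyMonomialPersists_holds`.
Ingredients, all PROVED: the two members of a regular system of parameters of a two-dimensional
regular local ring are non-associated prime elements generating a proper ideal (Matsumura
Thm. 14.2–14.3 via the tree's `RegularSystemOfParameters.lean`), so that the monomial lemmas of
`Literature/RingTheory/UniqueFactorizationDomain/TwoPrimes.lean` apply to the monomial form
`xᵢ = δᵢ y₁^{aᵢ₁} y₂^{aᵢ₂}`; polynomial bookkeeping for the substitution `P = V(W+γ), Q = V`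
(`blowupSubst`); a Nakayama argument in `A = F[P,Q]_{(P,Q)}`.
-/

noncomputable section

namespace Literature.Barriers.ResolutionOfSingularities

namespace Cutkosky

open Literature.AlgebraicGeometry.Resolution IsLocalRing

universe u

variable {S : Type u} [CommRing S] [IsRegularLocalRing S]

/-- In a regular local ring of dimension `2` the maximal ideal needs exactly two generators.
[folklore] -/
theorem spanFinrank_eq_two (hdim : ringKrullDim S = 2) : (maximalIdeal S).spanFinrank = 2 := by
  have h := IsRegularLocalRing.spanFinrank_maximalIdeal (R := S)
  rw [hdim] at h
  exact_mod_cast h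

/-- The maximal ideal of a two-dimensional regular local ring is not generated by one element.
[folklore] -/
theorem maximalIdeal_ne_span_singleton (hdim : ringKrullDim S = 2) (w : S) :
    maximalIdeal S ≠ Ideal.span {w} := by
  intro h
  have h2 := spanFinrank_eq_two hdim
  have hle : (maximalIdeal S).spanFinrank ≤ 1 := by
    rw [h]
    calc (Ideal.span {w}).spanFinrank ≤ ({w} : Set S).ncard :=
          Submodule.spanFinrank_span_le_ncard_of_finite (Set.finite_singleton w)
      _ = 1 := Set.ncard_singleton w
  omega

variable (hdim : ringKrullDim S = 2) (y : Fin 2 → S) (hy : Ideal.span (Set.range y) = maximalIdeal S)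
include hdim hy

omit hdim in
/-- `(y₁, y₂) = 𝔪` as a span of a pair. [folklore] -/
theorem span_pair_eq_maximalIdeal : Ideal.span ({y 0, y 1} : Set S) = maximalIdeal S := by
  rw [← hy]
  congr 1
  ext z
  simp only [Set.mem_insert_iff, Set.mem_singleton_iff, Set.mem_range]
  constructor
  · rintro (rfl | rfl); exacts [⟨0, rfl⟩, ⟨1, rfl⟩]
  · rintro ⟨i, rfl⟩; fin_cases i <;> simp

/-- Neither regular parameter divides the other. [folklore] -/
theorem not_dvd_of_rsop : ¬ y 0 ∣ y 1 ∧ ¬ y 1 ∣ y 0 := by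
  have hsp := span_pair_eq_maximalIdeal y hy
  constructor
  · intro hd
    apply maximalIdeal_ne_span_singleton hdim (y 0)
    rw [← hsp]
    apply le_antisymm
    · rw [Ideal.span_le]
      rintro z (rfl | rfl)
      · exact Ideal.subset_span rfl
      · exact (Ideal.mem_span_singleton).mpr hd
    · exact Ideal.span_mono (Set.singleton_subset_iff.mpr (Set.mem_insert _ _))
  · intro hd
    apply maximalIdeal_ne_span_singleton hdim (y 1)
    rw [← hsp]
    apply le_antisymm
    · rw [Ideal.span_le]
      rintro z (rfl | rfl)
      · exact (Ideal.mem_span_singleton).mpr hd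
      · exact Ideal.subset_span rfl
    · exact Ideal.span_mono (Set.singleton_subset_iff.mpr (Set.mem_insert_of_mem _ rfl))

/-- Regular parameters are nonzero. [folklore] -/
theorem rsop_ne_zero (i : Fin 2) : y i ≠ 0 := by
  have hsp := span_pair_eq_maximalIdeal y hy
  intro h0
  fin_cases i
  · apply maximalIdeal_ne_span_singleton hdim (y 1)
    rw [← hsp, show y 0 = 0 from h0, Ideal.span_insert, Ideal.span_singleton_eq_bot.mpr rfl, bot_sup_eq]
  · apply maximalIdeal_ne_span_singleton hdim (y 0)
    rw [← hsp, show y 1 = 0 from h0, Ideal.span_insert, Ideal.span_singleton_eq_bot.mpr rfl, sup_bot_eq]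

/-- **Regular parameters of a two-dimensional regular local ring are prime elements**
(Matsumura Thm. 14.2–14.3). [folklore] -/
theorem prime_rsop (i : Fin 2) : Prime (y i) := by
  have hd := spanFinrank_eq_two (S := S) hdim
  have hprime := isPrime_span_image hd y hy {i}
  rw [Finset.coe_singleton, Set.image_singleton] at hprime
  exact (Ideal.span_singleton_prime (rsop_ne_zero hdim y hy i)).mp hprime

omit hdim in
/-- `(y₁, y₂)` is a proper ideal. [folklore] -/
theorem span_pair_ne_top : Ideal.span ({y 0, y 1} : Set S) ≠ ⊤ := by
  rw [span_pair_eq_maximalIdeal y hy]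
  exact Ideal.IsPrime.ne_top inferInstance

/-- Divisibility of monomials in the regular parameters is componentwise. [folklore] -/
theorem le_of_pow_mul_pow_dvd {g₀ g₁ c d : ℕ} (hdvd : y 0 ^ g₀ * y 1 ^ g₁ ∣ y 0 ^ c * y 1 ^ d) :
    g₀ ≤ c ∧ g₁ ≤ d := by
  haveI := isDomain_of_isRegularLocalRing S
  have hp0 := prime_rsop hdim y hy 0
  have hp1 := prime_rsop hdim y hy 1
  obtain ⟨h01, h10⟩ := not_dvd_of_rsop hdim y hy
  constructor
  · by_contra hlt
    have hc : c + 1 ≤ g₀ := by omega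
    have h1 : y 0 ^ (c + 1) ∣ y 0 ^ c * y 1 ^ d :=
      (dvd_mul_of_dvd_left (pow_dvd_pow _ hc) _).trans hdvd
    rw [pow_succ, mul_dvd_mul_iff_left (pow_ne_zero _ hp0.ne_zero)] at h1
    exact h01 (hp0.dvd_of_dvd_pow h1)
  · by_contra hlt
    have hc : d + 1 ≤ g₁ := by omega
    have h1 : y 1 ^ (d + 1) ∣ y 0 ^ c * y 1 ^ d :=
      (dvd_mul_of_dvd_right (pow_dvd_pow _ hc) _).trans hdvd
    rw [mul_comm (y 0 ^ c), pow_succ, mul_dvd_mul_iff_left (pow_ne_zero _ hp1.ne_zero)] at h1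
    exact h10 (hp1.dvd_of_dvd_pow h1)

end Cutkosky

/-! ## Polynomial bookkeeping for the substitution `P = V(W + γ)`, `Q = V` -/

namespace Cutkosky

open _root_.MvPolynomial Literature.AlgebraicGeometry.Resolution IsLocalRing

universe v

variable {F : Type*} [Field F]

/-- The substitution `X₀ ↦ X₀ (X₁ + γ)`, `X₁ ↦ X₀` (`P = V(W+γ)`, `Q = V`). [folklore] -/
def blowupSubst (γ : F) : MvPolynomial (Fin 2) F →ₐ[F] MvPolynomial (Fin 2) F :=
  bind₁ ![X 0 * (X 1 + C γ), X 0]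

/-- The substitution preserves constant coefficients (both substitutes vanish at the origin).
[folklore] -/
theorem constantCoeff_blowupSubst (γ : F) (h : MvPolynomial (Fin 2) F) :
    constantCoeff (blowupSubst γ h) = constantCoeff h := by
  have h1 : (aeval (0 : Fin 2 → F)) (blowupSubst γ h) = aeval (0 : Fin 2 → F) h := by
    rw [blowupSubst, aeval_bind₁]
    congr 1
    ext i
    fin_cases i <;> simp
  rwa [aeval_zero, aeval_zero, Algebra.algebraMap_self, RingHom.id_apply, RingHom.id_apply] at h1

/-- Coefficients of pure `X₁`-monomials of a substituted polynomial: only the constant survives.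
[folklore] -/
theorem coeff_single_one_blowupSubst (γ : F) (h : MvPolynomial (Fin 2) F) (j : ℕ) :
    coeff (Finsupp.single 1 j) (blowupSubst γ h) = if j = 0 then constantCoeff h else 0 := by
  classical
  induction h using MvPolynomial.induction_on generalizing j with
  | C c =>
    rw [blowupSubst, bind₁_C_right, coeff_C, constantCoeff_C]
    by_cases hj : j = 0
    · subst hj; simp
    · rw [if_neg hj, if_neg]
      intro h0
      have := congrArg (fun m : Fin 2 →₀ ℕ => m 1) h0
      simp only [Finsupp.coe_zero, Pi.zero_apply, Finsupp.single_eq_same] at this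
      exact hj this.symm
  | add p q hp hq =>
    rw [map_add, coeff_add, hp, hq, map_add]
    split_ifs <;> ring
  | mul_X p i hp =>
    have hX : ∃ s : MvPolynomial (Fin 2) F, blowupSubst γ (X i) = X 0 * s := by
      fin_cases i
      · exact ⟨X 1 + C γ, by simp [blowupSubst, bind₁_X_right]⟩
      · exact ⟨1, by simp [blowupSubst, bind₁_X_right]⟩
    obtain ⟨s, hs⟩ := hX
    rw [map_mul, hs, mul_left_comm, coeff_X_mul', if_neg (by simp), map_mul, constantCoeff_X, mul_zero]
    simp

/-- The coefficient of `X₁ʲ` in `(X₁ + γ) · σA + σB`. [folklore] -/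
theorem coeff_single_one_N (γ : F) (A B : MvPolynomial (Fin 2) F) (j : ℕ) :
    coeff (Finsupp.single 1 j) ((X 1 + C γ) * blowupSubst γ A + blowupSubst γ B) =
      (if j = 1 then constantCoeff A else 0) +
        (if j = 0 then γ * constantCoeff A + constantCoeff B else 0) := by
  classical
  rw [coeff_add, add_mul, coeff_add, coeff_X_mul', coeff_C_mul, coeff_single_one_blowupSubst,
    coeff_single_one_blowupSubst]
  by_cases hj0 : j = 0
  · subst hj0; simp
  · have hjs : (1 : Fin 2) ∈ (Finsupp.single (1 : Fin 2) j).support := by simp [hj0]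
    rw [if_pos hjs, ← Finsupp.single_tsub, coeff_single_one_blowupSubst]
    by_cases hj1 : j = 1
    · subst hj1; simp
    · rw [if_neg (by omega), if_neg hj0, if_neg hj1, if_neg hj0, if_neg hj0]; ring

/-! ## The discharge -/

/-- A finitely supported function on `Fin 2` vanishing at `0` is a single at `1`. [folklore] -/
theorem finsupp_eq_single_one {m : Fin 2 →₀ ℕ} (hm : m 0 = 0) : m = Finsupp.single 1 (m 1) := by
  ext i
  fin_cases i
  · simp [hm]
  · simp

open Literature.RingTheory.UniqueFactorizationDomain in
/-- **Discharge of `CutkoskyMonomialPersists`** (Cutkosky §3 p. 7: monomial forms persist along a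
quadratic transform of the source dominated by the target). Proof: with `A → S` monomial via
`xᵢ = δᵢ y^{aᵢ}` and `Q` the blown-up parameter, `𝔪_A S = Q S` is principal, so `Q = ε y^{a_{i₀}}`
with `a_{i₀} ≤ a_{i₁}` (divisors of monomials / monomial ideal membership in the two non-associated
primes `y₁, y₂`); then `x_{i₀}/Q` is a unit, `x_{i₁}/Q = δ ε⁻¹ y^{a_{i₁} − a_{i₀}}` is not, and
`(Q, x_{i₁}/Q)` is a regular system of parameters of `A₁ = F[Q, P/Q − γ]_{(…)}` (a Nakayama
argument shows the `P`-linear coefficient of the numerator of `x_{i₁}` is nonzero), of monomial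
form with the same determinant up to sign. [cite: Cutkosky2014, §3 (p. 7)] -/
theorem CutkoskyMonomialPersists_holds : CutkoskyMonomialPersists.{v} := by
  intro F _ L _ _ P Q hPQ γ h' z hz h₁ hdom h₀ hmono
  classical
  letI := inclusionAlgebra h₁
  letI := inclusionAlgebra h₀
  haveI iR := isLocalRing_originLocalRing hPQ
  haveI iR₁ := isLocalRing_originLocalRing h'
  haveI iS := isLocalRing_originLocalRing hz
  haveI rR := isRegularLocalRing_originLocalRing hPQ
  haveI rR₁ := isRegularLocalRing_originLocalRing h'
  haveI rS := isRegularLocalRing_originLocalRing hz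
  haveI : IsDomain (originLocalRing hz) := isDomain_of_isRegularLocalRing _
  have hdimR : ringKrullDim (originLocalRing hPQ) = 2 := by
    have := ringKrullDim_originLocalRing hPQ; exact this
  have hdimR₁ : ringKrullDim (originLocalRing h') = 2 := by
    have := ringKrullDim_originLocalRing h'; exact this
  have hdimS : ringKrullDim (originLocalRing hz) = 2 := by
    have := ringKrullDim_originLocalRing hz; exact this
  obtain ⟨-, -, n, -, hdimSn, instR, instS, x, y, δ, a, hx, hy, hdet, hxy⟩ := hmono
  have hn : n = 2 := by
    have h2 : ((n : ℕ) : WithBot ℕ∞) = (2 : ℕ) := hdimSn.symm.trans (ringKrullDim_originLocalRing hz)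
    exact_mod_cast h2
  subst hn
  -- basic elements
  have hQ0 : Q ≠ 0 := by simpa using hPQ.ne_zero 1
  have hQR₁ : Q ∈ originLocalRing h' := by simpa using mem_originLocalRing_self h' 0
  have hWR₁ : P / Q - algebraMap F L γ ∈ originLocalRing h' := by simpa using mem_originLocalRing_self h' 1
  have hRR₁ : originLocalRing hPQ ≤ originLocalRing h' := originLocalRing_le_blowupPoint hPQ γ h'
  have hPQW : P = Q * (P / Q - algebraMap F L γ + algebraMap F L γ) := by
    rw [sub_add_cancel, mul_div_cancel₀ _ hQ0]
  -- primes of `S`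
  have hyS : Ideal.span (Set.range y) = maximalIdeal (originLocalRing hz) := hy
  have hp0 := prime_rsop hdimS y hyS 0
  have hp1 := prime_rsop hdimS y hyS 1
  obtain ⟨h01, h10⟩ := not_dvd_of_rsop hdimS y hyS
  have hproper := span_pair_ne_top y hyS
  -- `Q ∈ S`, `xᵢ / Q ∈ R₁`
  set qS : originLocalRing hz := ⟨Q, h₁ hQR₁⟩ with hqS
  have hxmem : ∀ i, (x i : L) / Q ∈ originLocalRing h' := by
    intro i
    have hxi : x i ∈ maximalIdeal (originLocalRing hPQ) := hx ▸ Ideal.subset_span ⟨i, rfl⟩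
    rw [maximalIdeal_originLocalRing hPQ, ← pair_eta (originCoord hPQ), range_pair, Ideal.mem_span_pair] at hxi
    obtain ⟨r, s, hrs⟩ := hxi
    have hval : (x i : L) = r * P + s * Q := by
      have := congrArg (fun w : originLocalRing hPQ => (w : L)) hrs
      simpa using this.symm
    have : (x i : L) / Q = r * (P / Q - algebraMap F L γ + algebraMap F L γ) + s := by
      rw [hval, sub_add_cancel, add_div, mul_div_assoc, mul_div_assoc, div_self hQ0, mul_one]
    rw [this]
    exact add_mem (mul_mem (hRR₁ r.2) (add_mem hWR₁ (Subalgebra.algebraMap_mem _ γ))) (hRR₁ s.2)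
  set t : Fin 2 → originLocalRing h' := fun i => ⟨(x i : L) / Q, hxmem i⟩ with ht
  set tS : Fin 2 → originLocalRing hz := fun i => ⟨(x i : L) / Q, h₁ (hxmem i)⟩ with htS
  have htS_alg : ∀ i, algebraMap (originLocalRing h') (originLocalRing hz) (t i) = tS i := fun i => rfl
  -- the monomial relations in `S`: `tᵢ · Q = δᵢ y₀^{aᵢ₀} y₁^{aᵢ₁}`
  have hmono : ∀ i, tS i * qS = δ i * (y 0 ^ a i 0 * y 1 ^ a i 1) := by
    intro i
    have h := hxy i
    rw [Fin.prod_univ_two] at h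
    rw [← h]
    apply Subtype.ext
    change (x i : L) / Q * Q = (x i : L)
    rw [div_mul_cancel₀ _ hQ0]
  -- (F1) `Q ∣ y^{aᵢ}`
  have hF1 : ∀ i, (qS : originLocalRing hz) ∣ y 0 ^ a i 0 * y 1 ^ a i 1 := by
    intro i
    refine ⟨↑(δ i)⁻¹ * tS i, ?_⟩
    calc y 0 ^ a i 0 * y 1 ^ a i 1 = ↑(δ i)⁻¹ * (δ i * (y 0 ^ a i 0 * y 1 ^ a i 1)) := by
          rw [← mul_assoc, Units.inv_mul, one_mul]
      _ = qS * (↑(δ i)⁻¹ * tS i) := by rw [← hmono i]; ring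
  -- (F2) `Q ∈ (y^{a₀}, y^{a₁})`
  have hF2 : (qS : originLocalRing hz) ∈
      Ideal.span ({y 0 ^ a 0 0 * y 1 ^ a 0 1, y 0 ^ a 1 0 * y 1 ^ a 1 1} : Set (originLocalRing hz)) := by
    have hQm : (originCoord hPQ 1) ∈ maximalIdeal (originLocalRing hPQ) := originCoord_mem_maximalIdeal hPQ 1
    rw [← hx, ← pair_eta x, range_pair, Ideal.mem_span_pair] at hQm
    obtain ⟨c₀, c₁, hc⟩ := hQm
    have hc' := congrArg (algebraMap (originLocalRing hPQ) (originLocalRing hz)) hc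
    rw [map_add, map_mul, map_mul, hxy 0, hxy 1, Fin.prod_univ_two, Fin.prod_univ_two] at hc'
    have hqS' : algebraMap (originLocalRing hPQ) (originLocalRing hz) (originCoord hPQ 1) = qS := rfl
    rw [hqS'] at hc'
    rw [← hc', Ideal.mem_span_pair]
    exact ⟨algebraMap _ _ c₀ * δ 0, algebraMap _ _ c₁ * δ 1, by ring⟩
  -- (DM) `Q = ε y^g`, `g ≤ a₀`
  obtain ⟨ε, g₀, g₁, hg0, hg1, hq⟩ := exists_eq_unit_mul_of_dvd hp0 hp1 _ _ _ (hF1 0)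
  -- orientation: `Q = ε y^{a i₀}` with `a i₀ ≤ a i₁`
  have horient : ∃ (i₀ i₁ : Fin 2), i₀ ≠ i₁ ∧ (qS : originLocalRing hz) = ε * y 0 ^ a i₀ 0 * y 1 ^ a i₀ 1 ∧
      a i₀ 0 ≤ a i₁ 0 ∧ a i₀ 1 ≤ a i₁ 1 := by
    have hmemg : y 0 ^ g₀ * y 1 ^ g₁ ∈
        Ideal.span ({y 0 ^ a 0 0 * y 1 ^ a 0 1, y 0 ^ a 1 0 * y 1 ^ a 1 1} : Set (originLocalRing hz)) := by
      have : y 0 ^ g₀ * y 1 ^ g₁ = ↑ε⁻¹ * qS := by rw [hq, ← mul_assoc, ← mul_assoc, Units.inv_mul, one_mul]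
      rw [this]
      exact Ideal.mul_mem_left _ _ hF2
    have hgq : y 0 ^ g₀ * y 1 ^ g₁ ∣ (qS : originLocalRing hz) := ⟨↑ε, by rw [hq]; ring⟩
    have hgdvd : y 0 ^ g₀ * y 1 ^ g₁ ∣ y 0 ^ a 1 0 * y 1 ^ a 1 1 := dvd_trans hgq (hF1 1)
    obtain ⟨hg0', hg1'⟩ := le_of_pow_mul_pow_dvd hdimS y hyS hgdvd
    rcases le_or_le_of_pow_mul_pow_mem_span hp0 hp1 h01 h10 hproper hmemg with ⟨h1, h2⟩ | ⟨h1, h2⟩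
    · have e0 : g₀ = a 0 0 := le_antisymm hg0 h1
      have e1 : g₁ = a 0 1 := le_antisymm hg1 h2
      subst e0; subst e1
      exact ⟨0, 1, by decide, hq, hg0', hg1'⟩
    · have e0 : g₀ = a 1 0 := le_antisymm hg0' h1
      have e1 : g₁ = a 1 1 := le_antisymm hg1' h2
      subst e0; subst e1
      exact ⟨1, 0, by decide, hq, hg0, hg1⟩
  clear hq hg0 hg1
  obtain ⟨i₀, i₁, hne, hq, hle0, hle1⟩ := horient
  have key2 : ∀ u v : Fin 2, u ≠ v → (u = 0 ∧ v = 1) ∨ (u = 1 ∧ v = 0) := by decide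
  have key3 : ∀ u v w : Fin 2, u ≠ v → w ≠ u → w = v := by decide
  -- the rows `a i₀`, `a i₁` differ
  have hrow : ¬ (a i₀ 0 = a i₁ 0 ∧ a i₀ 1 = a i₁ 1) := by
    rintro ⟨e0, e1⟩
    apply hdet
    apply Matrix.det_zero_of_row_eq hne
    ext j
    fin_cases j
    · simp [Matrix.map_apply, e0]
    · simp [Matrix.map_apply, e1]
  have hlt : a i₀ 0 < a i₁ 0 ∨ a i₀ 1 < a i₁ 1 := by
    rcases Nat.lt_or_ge (a i₀ 0) (a i₁ 0) with h | h
    · exact Or.inl h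
    · exact Or.inr (lt_of_le_of_ne hle1 fun e => hrow ⟨le_antisymm hle0 h, e⟩)
  -- (c3) `t i₁ = δ ε⁻¹ y^{a i₁ - a i₀}`, a non-unit
  have hY0 : (y 0 ^ a i₀ 0 * y 1 ^ a i₀ 1 : originLocalRing hz) ≠ 0 :=
    mul_ne_zero (pow_ne_zero _ hp0.ne_zero) (pow_ne_zero _ hp1.ne_zero)
  have hc3 : tS i₁ * ↑ε = δ i₁ * (y 0 ^ (a i₁ 0 - a i₀ 0) * y 1 ^ (a i₁ 1 - a i₀ 1)) := by
    have e1 : y 0 ^ a i₁ 0 = y 0 ^ (a i₁ 0 - a i₀ 0) * y 0 ^ a i₀ 0 := by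
      rw [← pow_add, Nat.sub_add_cancel hle0]
    have e2 : y 1 ^ a i₁ 1 = y 1 ^ (a i₁ 1 - a i₀ 1) * y 1 ^ a i₀ 1 := by
      rw [← pow_add, Nat.sub_add_cancel hle1]
    have h := hmono i₁
    rw [hq, e1, e2] at h
    apply mul_right_cancel₀ hY0
    linear_combination h
  have htS : tS i₁ = ↑(δ i₁) * ↑ε⁻¹ * (y 0 ^ (a i₁ 0 - a i₀ 0) * y 1 ^ (a i₁ 1 - a i₀ 1)) := by
    calc tS i₁ = tS i₁ * ↑ε * ↑ε⁻¹ := by rw [mul_assoc, Units.mul_inv, mul_one]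
      _ = _ := by rw [hc3]; ring
  have htS1max : tS i₁ ∈ maximalIdeal (originLocalRing hz) := by
    rw [htS]
    refine Ideal.mul_mem_left _ _ ?_
    have hy0m : y 0 ∈ maximalIdeal (originLocalRing hz) := hyS ▸ Ideal.subset_span ⟨0, rfl⟩
    have hy1m : y 1 ∈ maximalIdeal (originLocalRing hz) := hyS ▸ Ideal.subset_span ⟨1, rfl⟩
    rcases hlt with h | h
    · exact Ideal.mul_mem_right _ _ (Ideal.pow_mem_of_mem _ hy0m _ (Nat.sub_pos_of_lt h))
    · exact Ideal.mul_mem_left _ _ (Ideal.pow_mem_of_mem _ hy1m _ (Nat.sub_pos_of_lt h))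
  have ht1max : t i₁ ∈ maximalIdeal (originLocalRing h') := by
    rw [IsLocalRing.mem_maximalIdeal, mem_nonunits_iff]
    intro hu
    have hu' : IsUnit (tS i₁) := hu.map (algebraMap (originLocalRing h') (originLocalRing hz))
    exact ((IsLocalRing.mem_maximalIdeal _).mp htS1max) hu'
  -- (d) the numerator of `x i₁` and the substitution
  obtain ⟨f, g, hg, hxfg⟩ := (mem_originLocalRing_iff hPQ).mp (x i₁).2
  have hxi1 : x i₁ ∈ maximalIdeal (originLocalRing hPQ) := hx ▸ Ideal.subset_span ⟨i₁, rfl⟩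
  have hf0 : constantCoeff f = 0 := by
    have hmem : aeval ![P, Q] f / aeval ![P, Q] g ∈ originLocalRing hPQ := hxfg ▸ (x i₁).2
    have e : x i₁ = ⟨_, hmem⟩ := Subtype.ext hxfg
    rw [e] at hxi1
    exact (div_mem_maximalIdeal_originLocalRing_iff hPQ f g hg hmem).mp hxi1
  have hfspan : f ∈ Ideal.span ({X 0, X 1} : Set (MvPolynomial (Fin 2) F)) := by
    have h1 : f ∈ originIdeal F 2 := (mem_originIdeal_iff F 2).mpr hf0
    rw [originIdeal_eq_span, ← pair_eta (X : Fin 2 → MvPolynomial (Fin 2) F), range_pair] at h1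
    exact h1
  rw [Ideal.mem_span_pair] at hfspan
  obtain ⟨A, B, hAB⟩ := hfspan
  set σ := blowupSubst γ with hσ
  set N : MvPolynomial (Fin 2) F := (X 1 + C γ) * σ A + σ B with hNdef
  set G : MvPolynomial (Fin 2) F := σ g with hGdef
  have hσX0 : σ (X 0) = X 0 * (X 1 + C γ) := by simp [hσ, blowupSubst, bind₁_X_right]
  have hσX1 : σ (X 1) = X 0 := by simp [hσ, blowupSubst, bind₁_X_right]
  have hσf : σ f = X 0 * N := by
    rw [← hAB, map_add, map_mul, map_mul, hσX0, hσX1, hNdef]; ring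
  set ev : MvPolynomial (Fin 2) F →ₐ[F] L := aeval ![Q, P / Q - algebraMap F L γ] with hev
  have hevσ : ∀ h, ev (σ h) = aeval ![P, Q] h := by
    intro h
    rw [hev, hσ, blowupSubst, aeval_bind₁]
    congr 1
    ext i
    fin_cases i
    · simp only [Fin.zero_eta, Matrix.cons_val_zero, map_mul, map_add, aeval_X, Matrix.cons_val_one,
        aeval_C]
      exact hPQW.symm
    · simp
  have hG : constantCoeff G ≠ 0 := by rw [hGdef, constantCoeff_blowupSubst]; exact hg
  have hevG0 : ev G ≠ 0 := aeval_ne_zero_of_constantCoeff_ne_zero h' hG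
  have hNval : ((x i₁ : L)) / Q = ev N / ev G := by
    rw [hxfg, ← hevσ f, ← hevσ g, hσf, map_mul, ← hGdef]
    have : ev (X 0) = Q := by simp [hev]
    rw [this, mul_div_assoc, mul_div_cancel_left₀ _ hQ0]
  have hccN : constantCoeff N = γ * constantCoeff A + constantCoeff B := by
    rw [hNdef, map_add, map_mul, map_add, constantCoeff_X, constantCoeff_C, zero_add, constantCoeff_blowupSubst,
      constantCoeff_blowupSubst]
  have hmemNG : ev N / ev G ∈ originLocalRing h' := (mem_originLocalRing_iff h').mpr ⟨N, G, hG, rfl⟩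
  have hγab : γ * constantCoeff A + constantCoeff B = 0 := by
    rw [← hccN]
    have e : t i₁ = ⟨_, hmemNG⟩ := Subtype.ext hNval
    have h := ht1max
    rw [e] at h
    exact (div_mem_maximalIdeal_originLocalRing_iff h' N G hG hmemNG).mp h
  -- (e) `constantCoeff A ≠ 0` by Nakayama in `R`
  have ha0 : constantCoeff A ≠ 0 := by
    intro hA0
    have hB0 : constantCoeff B = 0 := by rw [hA0, mul_zero, zero_add] at hγab; exact hγab
    have hcoe : (fun i => ((originCoord hPQ i : originLocalRing hPQ) : L)) = ![P, Q] := by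
      funext i; fin_cases i <;> rfl
    have hAm : aeval (originCoord hPQ) A ∈ maximalIdeal (originLocalRing hPQ) :=
      aeval_mem_maximalIdeal_of_constantCoeff_eq_zero _ (originCoord_mem_maximalIdeal hPQ) hA0
    have hBm : aeval (originCoord hPQ) B ∈ maximalIdeal (originLocalRing hPQ) :=
      aeval_mem_maximalIdeal_of_constantCoeff_eq_zero _ (originCoord_mem_maximalIdeal hPQ) hB0
    obtain ⟨wg, hwg⟩ := isUnit_aeval_of_constantCoeff_ne_zero (originCoord hPQ) (originCoord_mem_maximalIdeal hPQ) hg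
    have hxeq : x i₁ = (aeval (originCoord hPQ) A * originCoord hPQ 0 + aeval (originCoord hPQ) B * originCoord hPQ 1) *
        ↑wg⁻¹ := by
      apply Subtype.ext
      rw [Subalgebra.coe_mul, coe_units_inv_subalgebra, hwg, Subalgebra.coe_add, Subalgebra.coe_mul,
        Subalgebra.coe_mul, coe_aeval_subalgebra, coe_aeval_subalgebra, coe_aeval_subalgebra, hcoe, hxfg,
        ← hAB, map_add, map_mul, map_mul, aeval_X, aeval_X, coe_originCoord, coe_originCoord]
      simp only [Matrix.cons_val_zero, Matrix.cons_val_one]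
      rw [div_eq_mul_inv]
    have hxsq : x i₁ ∈ maximalIdeal (originLocalRing hPQ) * maximalIdeal (originLocalRing hPQ) := by
      rw [hxeq]
      refine Ideal.mul_mem_right _ _ (Ideal.add_mem _ ?_ ?_)
      · exact Ideal.mul_mem_mul hAm (originCoord_mem_maximalIdeal hPQ 0)
      · exact Ideal.mul_mem_mul hBm (originCoord_mem_maximalIdeal hPQ 1)
    have hle : maximalIdeal (originLocalRing hPQ) ≤
        Ideal.span {x i₀} ⊔ maximalIdeal (originLocalRing hPQ) • maximalIdeal (originLocalRing hPQ) := by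
      conv_lhs => rw [← hx]
      rw [Ideal.span_le]
      rintro _ ⟨j, rfl⟩
      by_cases hj : j = i₀
      · subst hj
        exact Ideal.mem_sup_left (Ideal.subset_span rfl)
      · have hj' : j = i₁ := key3 _ _ _ hne hj
        subst hj'
        rw [Ideal.smul_eq_mul]
        exact Ideal.mem_sup_right hxsq
    have hle' := Submodule.le_of_le_smul_of_le_jacobson_bot (IsNoetherian.noetherian _)
      (IsLocalRing.maximalIdeal_le_jacobson ⊥) hle
    refine maximalIdeal_ne_span_singleton hdimR (x i₀) (le_antisymm hle' ?_)
    rw [Ideal.span_singleton_le_iff_mem]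
    exact hx ▸ Ideal.subset_span ⟨i₀, rfl⟩
  -- (f) `W ∈ (Q, t i₁)` in `R₁`
  have hNpoly : N - C (constantCoeff A) * X 1 ∈ Ideal.span ({X 0} : Set (MvPolynomial (Fin 2) F)) := by
    rw [show ({X 0} : Set (MvPolynomial (Fin 2) F)) = X '' {(0 : Fin 2)} by simp, mem_ideal_span_X_image]
    intro m hm
    by_contra hcon
    have hm0 : m 0 = 0 := by
      by_contra h0
      exact hcon ⟨0, rfl, h0⟩
    have hms := finsupp_eq_single_one hm0
    have hCX : ∀ j : ℕ, coeff (Finsupp.single (1 : Fin 2) j) (C (constantCoeff A) * X 1 : MvPolynomial (Fin 2) F) =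
        if j = 1 then constantCoeff A else 0 := by
      intro j
      rw [coeff_C_mul, coeff_X]
      by_cases hj1 : j = 1
      · subst hj1; simp
      · rw [if_neg, if_neg hj1, mul_zero]
        intro h
        have := congrArg (fun m : Fin 2 →₀ ℕ => m 1) h
        simp only [Finsupp.single_eq_same] at this
        exact hj1 this.symm
    rw [mem_support_iff, hms, coeff_sub, hNdef, coeff_single_one_N, hCX, hγab] at hm
    apply hm
    split_ifs <;> ring
  obtain ⟨M, hM⟩ := Ideal.mem_span_singleton'.mp hNpoly
  have hevM : ev N - algebraMap F L (constantCoeff A) * (P / Q - algebraMap F L γ) = ev M * Q := by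
    have h := congrArg ev hM
    rw [map_mul, map_sub, map_mul, aeval_C] at h
    have e0 : ev (X 0) = Q := by simp [hev]
    have e1 : ev (X 1) = P / Q - algebraMap F L γ := by simp [hev]
    rw [e0, e1] at h
    exact h.symm
  have htG : ((x i₁ : L)) / Q * ev G = ev N := by rw [hNval, div_mul_cancel₀ _ hevG0]
  have ha0L : algebraMap F L (constantCoeff A) ≠ 0 := by rw [map_ne_zero]; exact ha0
  have hWspan : (originCoord h' 1) ∈ Ideal.span ({originCoord h' 0, t i₁} : Set (originLocalRing h')) := by
    rw [Ideal.mem_span_pair]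
    refine ⟨-(algebraMap F (originLocalRing h') (constantCoeff A)⁻¹ * ⟨ev M, aeval_mem_originLocalRing h' M⟩),
      algebraMap F (originLocalRing h') (constantCoeff A)⁻¹ * ⟨ev G, aeval_mem_originLocalRing h' G⟩, Subtype.ext ?_⟩
    change -(algebraMap F L (constantCoeff A)⁻¹ * ev M) * Q +
      algebraMap F L (constantCoeff A)⁻¹ * ev G * ((x i₁ : L) / Q) = P / Q - algebraMap F L γ
    have key : algebraMap F L (constantCoeff A) * (P / Q - algebraMap F L γ) = (x i₁ : L) / Q * ev G - ev M * Q := by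
      linear_combination -htG - hevM
    rw [map_inv₀]
    apply mul_left_cancel₀ ha0L
    rw [key]
    have hainv : algebraMap F L (constantCoeff A) * (algebraMap F L (constantCoeff A))⁻¹ = 1 :=
      mul_inv_cancel₀ ha0L
    linear_combination (-(ev M) * Q + ev G * ((x i₁ : L) / Q)) * hainv
  -- (g) the new regular system of parameters of `R₁` and the monomial form
  have hy0m : y 0 ∈ maximalIdeal (originLocalRing hz) := hyS ▸ Ideal.subset_span ⟨0, rfl⟩
  have hspan : Ideal.span (Set.range ![originCoord h' 0, t i₁]) = maximalIdeal (originLocalRing h') := by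
    rw [range_pair]
    apply le_antisymm
    · rw [Ideal.span_le]
      rintro w (rfl | rfl)
      · exact originCoord_mem_maximalIdeal h' 0
      · exact ht1max
    · rw [maximalIdeal_originLocalRing h', ← pair_eta (originCoord h'), range_pair, Ideal.span_le]
      rintro w (rfl | rfl)
      · exact Ideal.subset_span (Set.mem_insert _ _)
      · exact hWspan
  have hdet2 : ((a i₀ 0 : ℤ) * a i₁ 1 - a i₀ 1 * a i₁ 0) ≠ 0 := by
    intro h
    apply hdet
    rw [Matrix.det_fin_two]
    simp only [Matrix.map_apply]
    rcases key2 i₀ i₁ hne with ⟨rfl, rfl⟩ | ⟨rfl, rfl⟩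
    · linear_combination h
    · linear_combination -h
  refine ⟨rR₁, rS, 2, hdimR₁, hdimS, iR₁, iS, ![originCoord h' 0, t i₁], y,
    ![ε, δ i₁ * ε⁻¹], Matrix.of ![![a i₀ 0, a i₀ 1], ![a i₁ 0 - a i₀ 0, a i₁ 1 - a i₀ 1]], hspan, hy, ?_, ?_⟩
  · rw [Matrix.det_fin_two]
    simp only [Matrix.map_apply, Matrix.of_apply, Matrix.cons_val_zero, Matrix.cons_val_one,
      Nat.cast_sub hle0, Nat.cast_sub hle1]
    intro h
    apply hdet2
    linear_combination h
  · intro i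
    fin_cases i
    · -- `Q = ε y^{a i₀}`
      rw [Fin.prod_univ_two]
      simp only [Fin.zero_eta, Matrix.cons_val_zero, Matrix.cons_val_one, Matrix.of_apply]
      rw [← mul_assoc, ← hq]
      rfl
    · -- `t i₁ = δ ε⁻¹ y^{a i₁ - a i₀}`
      rw [Fin.prod_univ_two]
      simp only [Fin.mk_one, Matrix.cons_val_one, Matrix.of_apply, Matrix.cons_val_zero]
      rw [show algebraMap (originLocalRing h') (originLocalRing hz) (t i₁) = tS i₁ from rfl, Units.val_mul, htS]

end Cutkosky



end Literature.Barriers.ResolutionOfSingularities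

end
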